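import Mathlib.FieldTheory.Galois.Infinite
import Mathlib.Algebra.Polynomial.SpecificDegree
import Literature.AnabelianGeometry.EtaleTheta.SettingModelChiTheta
import Literature.AnabelianGeometry.EtaleTheta.SettingModelGfpRigidity
import Literature.AnabelianGeometry.EtaleTheta.ThetaSettingOriginClauses
import Literature.AnabelianGeometry.EtaleTheta.Discharge.Sec1Thm16GKN
import Literature.AnabelianGeometry.EtaleTheta.Discharge.Sec1KerToZOfCompactNormalClosure
import HarnessLib

/-!
# The origin profile of the χ-twisted model: which clauses of `IsThm16Origin` / `IsTateOrigin` hold at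
# `ThetaSetting.modelχ p`

abc-iut cell, layer L2, R78 cluster (χ-TWISTED root model of [EtTh] §1, integrator abc-iut-L6-d6), file F9
(seat abc-iut-w5-d051 gen 3: author of the Tate-module clause text and of the ROOT-model profile
`SettingModelOriginProfile`, R44). Mochizuki, *The étale theta function …*, Publ. RIMS **45** (2009) [EtTh],
§1 pp. 12–13 [cite: MochizukiEtTh2009, §1 p.12]. abc-iut-L2-t6's predicate `ThetaSetting.IsThm16Origin D`
(`ThetaSettingOriginClauses.lean`) bundles the printed origin clauses Thm. 1.6 (i) consumes — R1
(`KerToZIsCompactlyGenerated`), R2 (`GtpYNFromCusp`), the cusp of `X^log`, R3 (two quotient topologies), TM₂;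
`ThetaSetting.IsTateOrigin D` is the Tate-module clause at every level. At the ROOT model (`Π^tp_X = F₂ × G_{ℚ_p}`
discrete) R1 FAILS (`SettingModelOriginProfile.not_kerToZIsCompactlyGenerated_model`). This file records the
truth values at abc-iut-L2-t1's χ-twisted model `ThetaSetting.modelχ p` (F5b `SettingModelChiTheta`:
`Π^tp_X = (F̂₂ ×_Ẑ ℤ) ⋊_χ G_{ℚ_p}`, `G_{ℚ_p}` with the KRULL topology, `K = ℚ_p`, `q_X = p²`, no closed point):

* **R1 HOLDS** (`kerToZIsCompactlyGenerated_modelχ`) — the FIRST model of the cell at which R1 is inhabited: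
  `Π^tp_Y = Ker pr₂ ⋊ G_{ℚ_p}` is generated by the two COMPACT subgroups `inl(Ker pr₂)`
  (`SettingModelGfpRigidity.isCompact_ker_gfpSnd`) and `inr(G_{ℚ_p})` (Krull-compact), so abc-iut-L6-d6's
  criterion `kerToZIsCompactlyGenerated_of_le_normalClosure` closes it — exactly what the DISCRETE `Gam p` of
  `model`/`model₂` forbids;
* R2 and [SemiAnbd] Thm. 6.5 (iii) hold VACUOUSLY and the cusp clause FAILS (`Pt := PEmpty`), hence
  `¬ (ThetaSetting.modelχ p).IsThm16Origin` BY THE CUSP CLAUSE ALONE (`not_isThm16Origin_modelχ`; the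
  cusp-carrying variant is abc-iut-w5-d029's `curveχ'`, whose `b`-axis inertia is known to break R2);
* **`IsTateOrigin` FAILS at level `N = 3`** (`modelχ_not_isTateOrigin`) although the Galois action on
  `(Δ^tp_Y)^ell` is now the cyclotomic one: the `a`-axis is UNTWISTED (`twist_eta_of_zero`: `σ·a = a`), so for
  `g = inr σ` and ANY lift `z = z_a·y₀` of `1 ∈ Z` (`y₀ ∈ Δ^tp_Y`) the commutator `[g, z]` is `z_a [g, y₀] z_a⁻¹`,
  whose ell-image lies in `3·(Δ^tp_Y)^ell` by the Tate-twist clause (b) as soon as `σ` FIXES `ζ₃`; the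
  Kummer clause (c) then forces `3 ∣ m` whenever `σ(r) = ζ₃^m r`, i.e. `σ` fixes `r = (p²)^{1/3}` — but
  `r ∉ ℚ_p(ζ₃)` (degrees `3 ∤ 2`: `X³ − p²` is irreducible over `ℚ_p` by valuation), so some `σ ∈ G_{ℚ_p(ζ₃)}`
  moves `r` (Galois correspondence for `ℚ̄_p/ℚ_p`). This is the kernel form of abc-iut-L6-d6's R78-MAP #2 (2)
  («with the diagonal θ_u the action on (Δ^tp_X)^ell is SPLIT … IsTateOrigin stays FALSE at modelχ»): the
  Kummer class of `q_X` is a non-trivial cocycle, never the coboundary a split `a`-axis produces; the repair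
  is the stage-2 affine action `θ_{u,k}` (abc-iut-L2-t6's shear, abc-iut-L2-t5's `κ_q`).

PROOF-ONLY (no definition, no named fact). Semi-synthetic model = consistency evidence only; nothing of [EtTh]
is asserted for the genuine tempered fundamental groups; no side is taken on [IUTchIII] Cor. 3.12;
typed ≠ proved.
-/

noncomputable section

namespace Literature.AnabelianGeometry.EtaleTheta.SettingModel

open Literature.AnabelianGeometry.SemiGraphs Thm16Sub Function Topology Polynomial

variable (p : ℕ) [Fact p.Prime]

/-! ### 1. The cusp clauses: no cusps at the χ-model -/

/-- `curveχ` has no closed points (`Pt := PEmpty`), so no subgroup of `Π^tp_X` is a cuspidal decomposition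
group. [cite: MochizukiEtTh2009, §1 p.12] -/
theorem not_isCuspidalDecompositionGroup_modelχ (Dc : Subgroup (PiTpχ p)) :
    ¬ (ThetaSetting.modelχ p).IsCuspidalDecompositionGroup Dc := by
  rintro ⟨x, -, -⟩
  exact PEmpty.elim x

/-- Likewise no subgroup is a cuspidal GEOMETRIC decomposition group. [cite: MochizukiEtTh2009, §1 p.12] -/
theorem not_isCuspidalGeometricDecompositionGroup_modelχ (I : Subgroup (PiTpχ p)) :
    ¬ (ThetaSetting.modelχ p).IsCuspidalGeometricDecompositionGroup I := by
  rintro ⟨x, -, -⟩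
  exact PEmpty.elim x

/-- **R2 holds at the χ-model, vacuously** (no cuspidal decomposition group inside `Π^tp_Y` to read `Y_N` off).
[cite: MochizukiEtTh2009, §1 p.13] -/
theorem modelχ_gtpYNFromCusp (N : ℕ+) : GtpYNFromCusp (ThetaSetting.modelχ p) N :=
  fun Dc hDc _ => (not_isCuspidalDecompositionGroup_modelχ p Dc hDc).elim

/-- **The cusp clause of `IsThm16Origin` fails at the χ-model** («`X^log` of type `(1,1)`» is not modelled
by `curveχ`). [cite: MochizukiEtTh2009, §1 p.12] -/
theorem not_exists_cuspidal_le_GtpY_modelχ :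
    ¬ ∃ Dc : Subgroup (ThetaSetting.modelχ p).PiTemp,
      (ThetaSetting.modelχ p).IsCuspidalDecompositionGroup Dc ∧ Dc ≤ (ThetaSetting.modelχ p).GtpY := by
  rintro ⟨Dc, hDc, -⟩
  exact not_isCuspidalDecompositionGroup_modelχ p Dc hDc

/-- [SemiAnbd] Thm. 6.5 (iii) holds VACUOUSLY for self-isomorphisms of the χ-model.
[cite: MochizukiEtTh2009, Thm 1.6 (i) p.24] -/
theorem modelχ_isoPreservesCuspidalDecomp :
    (ThetaSetting.modelχ p).IsoPreservesCuspidalDecomp (ThetaSetting.modelχ p).toTemperedCurve :=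
  fun _ D =>
    ⟨fun h => (not_isCuspidalDecompositionGroup_modelχ p D h).elim,
      fun h => (not_isCuspidalGeometricDecompositionGroup_modelχ p D h).elim⟩

/-- **The χ-model is NOT an origin setting — by the cusp clause alone.** [cite: MochizukiEtTh2009, §1 p.12] -/
theorem not_isThm16Origin_modelχ : ¬ (ThetaSetting.modelχ p).IsThm16Origin :=
  fun h => not_exists_cuspidal_le_GtpY_modelχ p h.exists_cuspidal_le_GtpY

/-! ### 2. R1 HOLDS at the χ-model -/

/-- Membership in `Π^tp_Y = Ker(Π^tp_X ↠ Z)` of the χ-model: `pr₂(g.left) = 0`. [cite: MochizukiEtTh2009, §1 p.12] -/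
theorem mem_GtpY_modelχ_iff (g : PiTpχ p) : g ∈ (ThetaSetting.modelχ p).GtpY ↔ gfpSnd g.left = 1 := by
  change g ∈ ((chiTwistData p).toZ).ker ↔ _
  rw [MonoidHom.mem_ker, GfpTwistData.toZ_apply]

/-- **R1 HOLDS at the χ-model**: `Π^tp_Y = Ker pr₂ ⋊ G_{ℚ_p}` is the closed subgroup topologically generated
by the compact subgroups of `Π^tp_X` — it is already generated by the two COMPACT subgroups `inl(Ker pr₂)`
(`Ker pr₂ ≅ Ker ê` closed in `F̂₂`) and `inr(G_{ℚ_p})` (Krull-compact), and compact subgroups die in `Z`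
(abc-iut-L6-d6's `kerToZIsCompactlyGenerated_of_le_normalClosure`). The first model of the cell where the
printed characterisation R1 of `Z` is inhabited (it fails at the discrete `model`/`model₂`).
[cite: MochizukiEtTh2009, §1 p.12] -/
theorem kerToZIsCompactlyGenerated_modelχ : KerToZIsCompactlyGenerated (ThetaSetting.modelχ p) := by
  haveI := compactSpace_GQp p
  -- the two compact generators
  let K : Bool → Subgroup (PiTpχ p) := fun b =>
    if b then (gfpSnd.ker).map (SemidirectProduct.inl : Gfp →* PiTpχ p)
    else (⊤ : Subgroup (GQp p)).map (SemidirectProduct.inr : GQp p →* PiTpχ p)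
  have hKt : K true = (gfpSnd.ker).map (SemidirectProduct.inl : Gfp →* PiTpχ p) := rfl
  have hKf : K false = (⊤ : Subgroup (GQp p)).map (SemidirectProduct.inr : GQp p →* PiTpχ p) := rfl
  refine ThetaSetting.kerToZIsCompactlyGenerated_of_le_normalClosure (ThetaSetting.modelχ p) K ?_ ?_
  · intro b
    cases b
    · rw [hKf, Subgroup.coe_map, Subgroup.coe_top]
      exact isCompact_univ.image (continuous_inrχ p)
    · rw [hKt, Subgroup.coe_map]
      exact isCompact_ker_gfpSnd.image (continuous_inlχ p)
  · intro g hg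
    rw [mem_GtpY_modelχ_iff] at hg
    refine Subgroup.le_topologicalClosure _ ?_
    rw [← SemidirectProduct.inl_left_mul_inr_right g]
    refine Subgroup.mul_mem _ (Subgroup.subset_normalClosure ?_) (Subgroup.subset_normalClosure ?_)
    · exact Set.mem_iUnion.mpr ⟨true, by rw [hKt]; exact ⟨g.left, hg, rfl⟩⟩
    · exact Set.mem_iUnion.mpr ⟨false, by rw [hKf]; exact ⟨g.right, Subgroup.mem_top _, rfl⟩⟩

/-! ### 3. `IsTateOrigin` FAILS at the χ-model (level `N = 3`) -/

/-- `p² ∈ ℚ_p` is not a cube: `3 · v(x) = 2` has no solution. [cite: Gouvea1993PadicNumbers, Prop 6.3.11] -/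
private theorem padic_pow_three_ne_sq' (x : ℚ_[p]) : x ^ 3 ≠ (p : ℚ_[p]) ^ 2 := by
  intro h
  have hp : (p : ℚ_[p]) ≠ 0 := Nat.cast_ne_zero.mpr (Fact.out : p.Prime).ne_zero
  have hx : x ≠ 0 := by
    rintro rfl
    rw [zero_pow three_ne_zero] at h
    exact pow_ne_zero 2 hp h.symm
  have hv := congrArg Padic.valuation h
  rw [Padic.valuation_pow, Padic.valuation_pow, Padic.valuation_p] at hv
  omega

/-- `X³ − p²` is the minimal polynomial of any cube root `r` of `p²` in `ℚ̄_p`, so `[ℚ_p(r) : ℚ_p] = 3`.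
[cite: MilneFT2022, Prop 1.25] -/
private theorem finrank_adjoin_cubeRoot {r : PadicAlgCl p} (hr : r ^ 3 = ((p : ℕ) : PadicAlgCl p) ^ 2) :
    Module.finrank ℚ_[p] (IntermediateField.adjoin ℚ_[p] {r}) = 3 := by
  have hint : IsIntegral ℚ_[p] r := Algebra.IsIntegral.isIntegral r
  let P : ℚ_[p][X] := X ^ 3 - C ((p : ℚ_[p]) ^ 2)
  have hPm : P.Monic := monic_X_pow_sub_C _ three_ne_zero
  have hPdeg : P.natDegree = 3 := natDegree_X_pow_sub_C
  have hPr : Polynomial.aeval r P = 0 := by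
    simp only [P, map_sub, map_pow, aeval_X, map_natCast]
    rw [hr, sub_self]
  have hirr : Irreducible P := by
    rw [hPm.irreducible_iff_roots_eq_zero_of_degree_le_three (by rw [hPdeg]; norm_num) (by rw [hPdeg]),
      Multiset.eq_zero_iff_forall_notMem]
    intro x hx
    rw [mem_roots hPm.ne_zero, IsRoot.def, eval_sub, eval_pow, eval_X, eval_C, sub_eq_zero] at hx
    exact padic_pow_three_ne_sq' p x hx
  have hmin : P = minpoly ℚ_[p] r := minpoly.eq_of_irreducible_of_monic hirr hPr hPm
  rw [IntermediateField.adjoin.finrank hint, ← hmin, hPdeg]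

/-- For a primitive cube root of unity `ζ ∈ ℚ̄_p`, `[ℚ_p(ζ) : ℚ_p] ≤ 2` (`ζ` is a root of `X² + X + 1`).
[cite: MilneFT2022, Prop 1.25] -/
private theorem finrank_adjoin_zeta_le {ζ : PadicAlgCl p} (hζ : IsPrimitiveRoot ζ 3) :
    Module.finrank ℚ_[p] (IntermediateField.adjoin ℚ_[p] {ζ}) ≤ 2 := by
  have hint : IsIntegral ℚ_[p] ζ := Algebra.IsIntegral.isIntegral ζ
  let Q : ℚ_[p][X] := X ^ 2 + X + 1
  have hQm : Q.Monic := by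
    show (X ^ 2 + X + 1 : ℚ_[p][X]).Monic
    have : (X ^ 2 + X + 1 : ℚ_[p][X]) = X ^ 2 + (X + 1) := by ring
    rw [this]
    exact Monic.add_of_left (monic_X_pow 2) (by
      rw [degree_X_pow]
      exact (degree_X_add_C 1).trans_lt (by norm_num))
  have hζ1 : ζ ≠ 1 := hζ.ne_one (by norm_num)
  have hQζ : Polynomial.aeval ζ Q = 0 := by
    have h3 : ζ ^ 3 = 1 := hζ.pow_eq_one
    have hfac : (ζ - 1) * (ζ ^ 2 + ζ + 1) = 0 := by linear_combination h3
    have h2 : ζ ^ 2 + ζ + 1 = 0 := by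
      rcases mul_eq_zero.mp hfac with h | h
      · exact absurd (sub_eq_zero.mp h) hζ1
      · exact h
    simp only [Q, map_add, map_pow, aeval_X, map_one]
    exact h2
  have hdeg := minpoly.min ℚ_[p] ζ hQm hQζ
  have hQdeg : Q.natDegree ≤ 2 := by
    show (X ^ 2 + X + 1 : ℚ_[p][X]).natDegree ≤ 2
    compute_degree!
  rw [IntermediateField.adjoin.finrank hint]
  exact (natDegree_le_natDegree hdeg).trans hQdeg

/-- **A cube root of `p²` does not lie in `ℚ_p(ζ₃)`** (degree `3` does not fit under degree `≤ 2`).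
[cite: MilneFT2022, Prop 1.25] -/
private theorem cubeRoot_not_mem_adjoin_zeta {ζ r : PadicAlgCl p} (hζ : IsPrimitiveRoot ζ 3)
    (hr : r ^ 3 = ((p : ℕ) : PadicAlgCl p) ^ 2) : r ∉ IntermediateField.adjoin ℚ_[p] {ζ} := by
  intro hmem
  have hζint : IsIntegral ℚ_[p] ζ := Algebra.IsIntegral.isIntegral ζ
  haveI := IntermediateField.adjoin.finiteDimensional hζint
  have hle : IntermediateField.adjoin ℚ_[p] {r} ≤ IntermediateField.adjoin ℚ_[p] {ζ} :=
    IntermediateField.adjoin_simple_le_iff.mpr hmem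
  have h := IntermediateField.finrank_le_of_le_right hle
  rw [finrank_adjoin_cubeRoot p hr] at h
  have h2 := finrank_adjoin_zeta_le p hζ
  omega

/-- **Some `σ ∈ G_{ℚ_p}` fixes `ζ₃` and moves `(p²)^{1/3}`** (Galois correspondence for `ℚ̄_p/ℚ_p` at the
closed subgroup `G_{ℚ_p(ζ₃)}`). [cite: MilneFT2022, Thm 7.13] -/
private theorem exists_gal_fix_zeta_move_cubeRoot {ζ r : PadicAlgCl p} (hζ : IsPrimitiveRoot ζ 3)
    (hr : r ^ 3 = ((p : ℕ) : PadicAlgCl p) ^ 2) : ∃ σ : GQp p, σ ζ = ζ ∧ σ r ≠ r := by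
  by_contra hall
  push Not at hall
  haveI : IsGalois ℚ_[p] (PadicAlgCl p) := {}
  have hmem : r ∈ IntermediateField.fixedField (IntermediateField.adjoin ℚ_[p] {ζ}).fixingSubgroup := by
    rw [IntermediateField.mem_fixedField_iff]
    intro σ hσ
    have hσζ : σ ζ = ζ :=
      (IntermediateField.mem_fixingSubgroup_iff _ σ).mp hσ ζ (IntermediateField.mem_adjoin_simple_self _ ζ)
    exact hall σ hσζ
  rw [InfiniteGalois.fixedField_fixingSubgroup] at hmem
  exact cubeRoot_not_mem_adjoin_zeta p hζ hr hmem

/-- The graph element `(η a, 1) ∈ Γ` of the generator `a` (a lift of `1 ∈ Z`). [cite: MochizukiEtTh2009, §1 p.12] -/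
private theorem eta_a_mem_Gfp :
    ((eta (FreeGroup.of 0), Multiplicative.ofAdd (1 : ℤ)) : F₂hatT × Multiplicative ℤ) ∈ Gfp := by
  have h := eta_mk_mem_Gfp (FreeGroup.of 0)
  rwa [expA_apply, heisHom_of_zero] at h

/-- **The `a`-axis is untwisted**: `G_{ℚ_p}` fixes the graph element of `a` in the χ-model (`θ_u(a) = a`).
[cite: MochizukiEtTh2009, §1 p.12] -/
theorem actχ_eta_a (σ : GQp p) :
    actχ p σ ⟨(eta (FreeGroup.of 0), Multiplicative.ofAdd (1 : ℤ)), eta_a_mem_Gfp⟩ =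
      ⟨(eta (FreeGroup.of 0), Multiplicative.ofAdd (1 : ℤ)), eta_a_mem_Gfp⟩ := by
  apply Subtype.ext
  rw [actχ_apply, coe_twistGfp]
  exact Prod.ext (twist_eta_of_zero _) rfl

/-- In the ell-quotient, elements of `Δ^tp_X` commute. [cite: MochizukiEtTh2009, §1 p.12] -/
private theorem toEll_mul_comm_of_mem_delta (D : ThetaSetting p) {x y : D.PiTemp} (hx : x ∈ D.DeltaTemp)
    (hy : y ∈ D.DeltaTemp) : toEll D x * toEll D y = toEll D y * toEll D x := by
  have h := toEll_commutator_eq_one_of_mem_delta D hx hy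
  rw [map_mul, map_mul, map_mul, map_inv, map_inv, mul_inv_eq_one, mul_inv_eq_iff_eq_mul] at h
  exact h

/-- **`IsTateOrigin` FAILS at the χ-model** at level `N = 3` (stage 1: the `a`-axis is untwisted). Given the
clause data `(y₁, z, ζ, r)`: pick `σ ∈ G_{ℚ_p}` fixing `ζ` with `σ r ≠ r` (`exists_gal_fix_zeta_move_cubeRoot`),
`σ r = ζ^m r` with `0 < m < 3`; put `g := inr σ`, `z = z_a · y₀` with `z_a = inl(η a, 1)` (fixed by `g`) and
`y₀ ∈ Δ^tp_Y`. Then `[g, z] = z_a [g, y₀] z_a⁻¹` has ell-image `(g y₀ g⁻¹)^ell (y₀^ell)⁻¹ ∈ 3·(Δ^tp_Y)^ell` by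
the Tate-twist clause (b) with `k = 1`; the Kummer clause (c) then puts `(ȳ₁^m)⁻¹` in `3·(Δ^tp_Y)^ell`, so `3 ∣ m`
by (a′) — contradiction. [cite: MochizukiEtTh2009, §1 p.13] -/
theorem modelχ_not_isTateOrigin : ¬ (ThetaSetting.modelχ p).IsTateOrigin := by
  intro h
  set D := ThetaSetting.modelχ p with hD
  obtain ⟨y₁, z, ζ, r, -, hz, hzZ, hζ, hr, -, hord, htw, hkum⟩ := h.tate 3
  have h3 : ((3 : ℕ+) : ℕ) = 3 := rfl
  rw [h3] at hζ hr hord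
  have hp0 : ((p : ℕ) : PadicAlgCl p) ≠ 0 := Nat.cast_ne_zero.mpr (Fact.out : p.Prime).ne_zero
  have hr' : r ^ 3 = ((p : ℕ) : PadicAlgCl p) ^ 2 := hr
  have hr0 : r ≠ 0 := by
    rintro rfl
    rw [zero_pow three_ne_zero] at hr'
    exact pow_ne_zero 2 hp0 hr'.symm
  obtain ⟨σ, hσζ, hσr⟩ := exists_gal_fix_zeta_move_cubeRoot p hζ hr'
  -- `σ r / r` is a cube root of unity, hence a power of the primitive `ζ`
  have hroot : (σ r / r) ^ 3 = 1 := by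
    rw [div_pow, ← map_pow, hr', map_pow, map_natCast, div_self (pow_ne_zero 2 hp0)]
  obtain ⟨m, hm3, hm⟩ := hζ.eq_pow_of_pow_eq_one hroot
  have hσr' : σ r = ζ ^ m * r := by rw [hm, div_mul_cancel₀ _ hr0]
  -- the Galois element as an element of `Π^tp_X`, and the decomposition `z = z_a * y₀`
  let g : D.PiTemp := (SemidirectProduct.inr σ : PiTpχ p)
  let za : D.PiTemp :=
    (SemidirectProduct.inl ⟨(eta (FreeGroup.of 0), Multiplicative.ofAdd (1 : ℤ)), eta_a_mem_Gfp⟩ : PiTpχ p)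
  have hgza : g * za * g⁻¹ = za := by
    change (SemidirectProduct.inr σ : PiTpχ p) * SemidirectProduct.inl _ * (SemidirectProduct.inr σ)⁻¹ =
      SemidirectProduct.inl _
    rw [← map_inv, ← SemidirectProduct.inl_aut, actχ_eta_a]
  have hza_delta : za ∈ D.DeltaTemp := (mem_deltaTempχ_iff p _).mpr (SemidirectProduct.right_inl _)
  have hza_Z : D.toZ za = Multiplicative.ofAdd 1 := by
    change (chiTwistData p).toZ _ = _
    rw [GfpTwistData.toZ_apply, SemidirectProduct.left_inl, gfpSnd_apply]
  let y₀ : D.PiTemp := za⁻¹ * z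
  have hy₀_delta : y₀ ∈ D.DeltaTemp := D.DeltaTemp.mul_mem (D.DeltaTemp.inv_mem hza_delta) hz
  have hy₀_Y : y₀ ∈ D.GtpY := by
    change y₀ ∈ D.toZ.ker
    rw [MonoidHom.mem_ker, map_mul, map_inv, hza_Z, hzZ, inv_mul_cancel]
  have hy₀ : y₀ ∈ D.DtpY := Subgroup.mem_inf.mpr ⟨hy₀_Y, hy₀_delta⟩
  have hz_eq : z = za * y₀ := by rw [mul_inv_cancel_left]
  -- the aug-values of `g`
  have haug : ∀ x : PadicAlgCl p, D.aug g x = σ x := fun x => rfl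
  have haugζ : D.aug g ζ = ζ ^ 1 := by rw [haug, pow_one, hσζ]
  have haugr : D.aug g r = ζ ^ m * r := by rw [haug, hσr']
  -- the commutator `[g, z]` in the ell-quotient
  have hgy₀_delta : g * y₀ * g⁻¹ ∈ D.DeltaTemp := (deltaTemp_normal D).conj_mem _ hy₀_delta g
  have hkey : toEll D (g * z * g⁻¹ * z⁻¹) = toEll D (g * y₀ * g⁻¹) * (toEll D y₀)⁻¹ := by
    have hc : g * z * g⁻¹ * z⁻¹ = za * ((g * y₀ * g⁻¹) * y₀⁻¹) * za⁻¹ := by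
      rw [hz_eq, mul_inv_rev]
      calc g * (za * y₀) * g⁻¹ * (y₀⁻¹ * za⁻¹)
          = (g * za * g⁻¹) * (g * y₀ * g⁻¹) * y₀⁻¹ * za⁻¹ := by group
        _ = za * (g * y₀ * g⁻¹) * y₀⁻¹ * za⁻¹ := by rw [hgza]
        _ = za * ((g * y₀ * g⁻¹) * y₀⁻¹) * za⁻¹ := by group
    rw [hc, map_mul, map_mul, toEll_mul_comm_of_mem_delta p D hza_delta
      (D.DeltaTemp.mul_mem hgy₀_delta (D.DeltaTemp.inv_mem hy₀_delta)), map_inv, mul_assoc,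
      mul_inv_cancel, mul_one, map_mul, map_inv]
  -- clause (b) with `k = 1`, clause (c), and the order clause (a′)
  have hb := htw g 1 haugζ y₀ hy₀
  rw [pow_one] at hb
  have hc := hkum g m haugr
  rw [hkey] at hc
  have hmem : toEll D y₁ ^ m ∈ ellPowersY D 3 := by
    have := (ellPowersY D 3).mul_mem ((ellPowersY D 3).inv_mem hb) hc
    rwa [inv_mul_cancel_left, inv_mem_iff] at this
  rw [hord m] at hmem
  have hm0 : m = 0 := Nat.eq_zero_of_dvd_of_lt hmem hm3
  exact hσr (by rw [hσr', hm0, pow_zero, one_mul])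

/-! ### 4. Summary rows for the NV register -/

/-- **The profile, bundled**: at the χ-model R1 ✓ (new), R2 ✓ (vacuous), the cusp clause ✗, hence
`IsThm16Origin` ✗; and `IsTateOrigin` ✗ (level `3`, split `a`-axis). Together with `modelχ_isEtThOrigin`
(F5b): root + guard + R1 are jointly satisfiable. [cite: MochizukiEtTh2009, §1 p.12] -/
theorem modelχ_origin_profile :
    (ThetaSetting.modelχ p).IsEtThOrigin ∧ KerToZIsCompactlyGenerated (ThetaSetting.modelχ p) ∧
      (∀ N : ℕ+, GtpYNFromCusp (ThetaSetting.modelχ p) N) ∧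
      ¬ (ThetaSetting.modelχ p).IsThm16Origin ∧ ¬ (ThetaSetting.modelχ p).IsTateOrigin :=
  ⟨ThetaSetting.modelχ_isEtThOrigin p, kerToZIsCompactlyGenerated_modelχ p, modelχ_gtpYNFromCusp p,
    not_isThm16Origin_modelχ p, modelχ_not_isTateOrigin p⟩

/-- **R1 is consistent with root + guard**: `∃ D, D.IsEtThOrigin ∧ KerToZIsCompactlyGenerated D` — witnessed by
the χ-model (at the discrete models R1 is refuted). [cite: MochizukiEtTh2009, §1 p.12] -/
theorem _root_.Literature.AnabelianGeometry.EtaleTheta.ThetaSetting.exists_isEtThOrigin_and_kerToZIsCompactlyGenerated :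
    ∃ D : ThetaSetting p, D.IsEtThOrigin ∧ KerToZIsCompactlyGenerated D :=
  ⟨ThetaSetting.modelχ p, ThetaSetting.modelχ_isEtThOrigin p, kerToZIsCompactlyGenerated_modelχ p⟩

end Literature.AnabelianGeometry.EtaleTheta.SettingModel

end
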